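import Summits.QuantumFields.YangMills.Theorems.BalabanUVNodesN09OneBondChartRead
import Literature.MathematicalPhysics.QuantumFieldTheory.Balaban1983to89.HaarExpChartLocal
import Literature.MathematicalPhysics.QuantumFieldTheory.Balaban1983to89.HaarExpChartLocalFaceTransport
import Literature.MathematicalPhysics.QuantumFieldTheory.Balaban1983to89.BlockAveragingPlaquetteBound
import Literature.MathematicalPhysics.QuantumFieldTheory.Balaban1983to89.BlockAveragingCentralBlind
import Mathlib.Analysis.Calculus.FDeriv.Measurable
import Mathlib.Analysis.SpecialFunctions.Exponential
import HarnessLib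

/-!
# BalabanUVNodes ∕ N09 — THE ONE-VARIABLE (0.4) FIBRE MAP ON THE CENTRAL `α`-WINDOW READ IN ONE EXPONENTIAL CHART: window geometry in `SU(N)`, the jointly analytic matrix
# model `Φ((V,B),X) = proj(log(Ê(V,B)⋆ · Ê(V, B·e^X)))`, and its identification with the tree's `fibreMap`

Cell `pub-ymgap` (YM-PLAN Track A), width seat `pub-ymgap-dag-n09-w4` g5 (FILE 8 = INTENT-6b); count-neutral helper of K1⁹ = stmt-QuantumFields-27364 (`--supports`, `--as helper`).
[I] = [Balaban1987RG1].  The located piece (F) of dag-n09-w6's road (`…N09CentralWindowAtRecord.exists_perBondCharts_of_forwardLaws`) asks for the forward Jacobian law of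
the one-variable map `g ↦ Ū(U[β(c) ↦ g])(c) = E(pre·g·post)`, `E = fibreMap ℰ U c` (pub-balaban's `BlockAveragingEMLHaarAC`), on the W-window `S = {W | ∀ i, dist1 (fibreFamily U c W i) ≤ α}`,
with a density that is JOINTLY measurable in `(U, g)`.  Both are obtained from ONE chart at the off-central open holonomy `b = V_{i₀}(U)` and a matrix model of the chart read that
is jointly analytic in the open holonomies `V`, the base point `B` and the chart variable `X` — so that its `X`-derivative is a Borel function of everything (`measurable_fderiv`).

WHAT IS PROVED (0 def, 0 sorry).  §1 geometry: `norm_coe_mul_star_sub_one` (`‖V·W⋆ − 1‖ = ‖V − W‖`), `norm_coe_inv_mul_sub_one`, `norm_openHol_sub_le_of_mem` (window ⇒ `‖V_i − W‖ ≤ α`),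
`norm_openHol_sub_openHol_le` (`2α`), `norm_coe_fibreFamily(_openHol)_sub_one_le`, `mem_window_of_norm_sub_one_le`, ★ `radii_of_le_deltaSU` (under `64·α ≤ δ_N`: `19α < r_C`, `38α < s_C`,
`19α ≤ 1∕2`, `2α < δ_N`; `r_C = min(1∕3, 3∕N)`, `s_C ≥ r_C∕(1 + r_C)`, `π < 3.15`).  §2 model: `contDiff_familyM`, ★ `contDiffAt_modelE` (`Ê(V,A) = eml(i ↦ central ? 1 : V_i A⋆)·A` is `C^ω`
jointly where the family is in `‖· − 1‖ < 1` — pub-balaban's `analyticAt_eml`), ★★ `contDiffAt_modelChart` (`Φ` is `C^ω` jointly in `((V,B),X)`).  §3 identification: ★ `coe_fibreMap_eq_modelE`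
(`↑(fibreMap ℰ U c W) = Ê(V(U), ↑W)` on the guard, `coe_avg_expMeanLogSU`), `fibreSmall_of_mem_window`, `fibreSmall_openHol_of_mem_window`, `coe_expChart_SU`,
`star_modelE_mul_modelE_eq_coe`, ★★ `modelChart_apply_eq_logChart` (the slice of `Φ` at `(V(U), ↑b)` IS the chart read `X ↦ Λ(E(b)⁻¹·E(b·Θ X))`), `norm_coe_avg_fibreFamily_sub_one_le`
([Balaban1985Averaging] (26)–(27): `≤ 6t`), ★ `norm_coe_fibreMap_inv_mul_sub_one_le` (`‖↑(E(b)⁻¹E(W)) − 1‖ ≤ 19α` on the window).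

HONEST FRAMING.  Count-neutral; classical Lie-group chart calculus ∕ change of variables BY NAME on the tree's typed (0.4) objects; nothing of Bałaban's estimates asserted;
`hreg` NOT discharged; N09 NOT discharged; conjunct 1 (Lemma 4) ∕ FLAG №7 untouched; K0⁷ ∕ K1⁹ ∕ K3⁸ NOT closed; counts unmoved; one finite four-torus programme at fixed
`ε = L^{−K}` — R4 closes the conditional rung `BalabanLadder.UV` only; NOT ℝ⁴ ∕ infinite volume ∕ OS; the Yang–Mills mass gap (Clay) is NOT proved by any of this.
-/

noncomputable section

open scoped Matrix.Norms.L2Operator Topology ContDiff ENNReal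
open Filter Set Function MeasureTheory NormedSpace

namespace Summit.QuantumFields.YangMills.BalabanUVNodes.N09CentralWindowChart

open Literature.MathematicalPhysics.QuantumFieldTheory.Balaban1983to89
open Literature.MathematicalPhysics.QuantumFieldTheory.Balaban1983to89.HaarExponentialChart
open Literature.MathematicalPhysics.QuantumFieldTheory.Balaban1983to89.HaarExponentialChart.IsChartRep
open Literature.MathematicalPhysics.QuantumFieldTheory.Balaban1983to89.BlockAveraging (Small Idx avgFun loopHol instNonemptyIdx)
open Literature.MathematicalPhysics.QuantumFieldTheory.Balaban1983to89.BlockAveragingHaarAC (centralBond pre post openHol IsCentral)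
open Literature.MathematicalPhysics.QuantumFieldTheory.Balaban1983to89.BlockAveragingEMLHaarAC (fibreFamily fibreMap FibreSmall fibreGuard
  fibreFamily_of_isCentral coe_fibreFamily_of_not_isCentral dist1_fibreFamily_of_not_isCentral coe_avg_expMeanLogSU fibreMap_of_mem)
open Literature.MathematicalPhysics.QuantumFieldTheory.Balaban1983to89.ExpMeanLog (eml expMeanLogSU deltaSU eml_eq_exp analyticAt_eml)
open Literature.MathematicalPhysics.QuantumFieldTheory.Balaban1983to89.MatrixLog (mlog analyticAt_mlog norm_mlog_le_two_mul exp_mlog)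
open Literature.MathematicalPhysics.QuantumFieldTheory.Balaban1983to89.Node00

variable {P : Params} {j : ℕ} {N : ℕ} [NeZero N]

/-! ## §1  Geometry of the central `α`-window `S = {W | ∀ i, dist1 (fibreFamily U c W i) ≤ α}` in `SU(N)` -/

section Geometry

omit [NeZero N] in
/-- Left multiplication by (the matrix of) an element of `SU(N)` preserves the operator norm. [cite: Balaban1987RG1, (0.4) p.253 (bookkeeping)] -/
theorem norm_coe_mul (g : SU N) (M : Matrix (Fin N) (Fin N) ℂ) : ‖(g : Matrix (Fin N) (Fin N) ℂ) * M‖ = ‖M‖ :=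
  CStarRing.norm_coe_unitary_mul ⟨(g : Matrix (Fin N) (Fin N) ℂ), Matrix.specialUnitaryGroup_le_unitaryGroup g.2⟩ M

omit [NeZero N] in
/-- Right multiplication by (the matrix of) an element of `SU(N)` preserves the operator norm. [cite: Balaban1987RG1, (0.4) p.253 (bookkeeping)] -/
theorem norm_mul_coe (M : Matrix (Fin N) (Fin N) ℂ) (g : SU N) : ‖M * (g : Matrix (Fin N) (Fin N) ℂ)‖ = ‖M‖ :=
  CStarRing.norm_mul_coe_unitary M ⟨(g : Matrix (Fin N) (Fin N) ℂ), Matrix.specialUnitaryGroup_le_unitaryGroup g.2⟩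

omit [NeZero N] in
/-- Right multiplication by `star` of (the matrix of) an element of `SU(N)` preserves the operator norm. [cite: Balaban1987RG1, (0.4) p.253 (bookkeeping)] -/
theorem norm_mul_star_coe (M : Matrix (Fin N) (Fin N) ℂ) (g : SU N) : ‖M * star (g : Matrix (Fin N) (Fin N) ℂ)‖ = ‖M‖ := by
  rw [← coe_inv_SU]; exact norm_mul_coe M g⁻¹

omit [NeZero N] in
/-- `‖V·W* − 1‖ = ‖V − W‖` for `V, W ∈ SU(N)`. [cite: Balaban1987RG1, (0.4) p.253 (bookkeeping)] -/
theorem norm_coe_mul_star_sub_one (V W : SU N) :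
    ‖(V : Matrix (Fin N) (Fin N) ℂ) * star (W : Matrix (Fin N) (Fin N) ℂ) - 1‖ = ‖(V : Matrix (Fin N) (Fin N) ℂ) - W‖ := by
  have h1 : (V : Matrix (Fin N) (Fin N) ℂ) * star (W : Matrix (Fin N) (Fin N) ℂ) - 1 =
      ((V : Matrix (Fin N) (Fin N) ℂ) - W) * star (W : Matrix (Fin N) (Fin N) ℂ) := by
    rw [sub_mul, coe_mul_star_coe_SU]
  rw [h1, norm_mul_star_coe]

omit [NeZero N] in
/-- `‖↑(b⁻¹·W) − 1‖ = ‖W − b‖` for `b, W ∈ SU(N)`. [cite: Balaban1987RG1, (0.4) p.253 (bookkeeping)] -/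
theorem norm_coe_inv_mul_sub_one (b W : SU N) :
    ‖((b⁻¹ * W : SU N) : Matrix (Fin N) (Fin N) ℂ) - 1‖ = ‖(W : Matrix (Fin N) (Fin N) ℂ) - b‖ := by
  have h1 : ((b⁻¹ * W : SU N) : Matrix (Fin N) (Fin N) ℂ) - 1 = star (b : Matrix (Fin N) (Fin N) ℂ) * ((W : Matrix (Fin N) (Fin N) ℂ) - b) := by
    rw [Submonoid.coe_mul, coe_inv_SU, mul_sub, star_coe_mul_coe_SU]
  rw [h1, ← coe_inv_SU, norm_coe_mul]

/-- **In the central `α`-window every off-central open holonomy is `α`-close to `W`**: `‖V_i − W‖ ≤ α`. [cite: Balaban1987RG1, (0.4) p.253 and (2.9) p.266] -/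
theorem norm_openHol_sub_le_of_mem (U : GaugeField P j (SU N)) (c : PBond P (j + 1)) {α : ℝ} {W : SU N}
    (hW : ∀ i : Idx P, dist1 (fibreFamily U c W i) ≤ α) {i : Idx P} (hi : ¬ IsCentral c i) :
    ‖((openHol U c i : SU N) : Matrix (Fin N) (Fin N) ℂ) - W‖ ≤ α := by
  have h := hW i
  rwa [dist1_fibreFamily_of_not_isCentral U c W i hi, norm_coe_mul_star_sub_one] at h

/-- The W-coordinate family of a window point is `α`-close to `1` in matrices (central entries are `1`). [cite: Balaban1987RG1, (0.4) p.253 and (2.9) p.266] -/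
theorem norm_coe_fibreFamily_sub_one_le (U : GaugeField P j (SU N)) (c : PBond P (j + 1)) {α : ℝ} (hα0 : 0 ≤ α) {W : SU N}
    (hW : ∀ i : Idx P, dist1 (fibreFamily U c W i) ≤ α) (i : Idx P) :
    ‖((fibreFamily U c W i : SU N) : Matrix (Fin N) (Fin N) ℂ) - 1‖ ≤ α := by
  by_cases hi : IsCentral c i
  · rw [fibreFamily_of_isCentral U c W i hi]; simpa using hα0
  · rw [coe_fibreFamily_of_not_isCentral U c W i hi, norm_coe_mul_star_sub_one]; exact norm_openHol_sub_le_of_mem U c hW hi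

/-- Two off-central open holonomies of a NONEMPTY window are `2α`-close. [cite: Balaban1987RG1, (0.4) p.253 and (2.9) p.266] -/
theorem norm_openHol_sub_openHol_le (U : GaugeField P j (SU N)) (c : PBond P (j + 1)) {α : ℝ} {W : SU N}
    (hW : ∀ i : Idx P, dist1 (fibreFamily U c W i) ≤ α) {i i' : Idx P} (hi : ¬ IsCentral c i) (hi' : ¬ IsCentral c i') :
    ‖((openHol U c i : SU N) : Matrix (Fin N) (Fin N) ℂ) - openHol U c i'‖ ≤ 2 * α := by
  calc ‖((openHol U c i : SU N) : Matrix (Fin N) (Fin N) ℂ) - openHol U c i'‖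
      ≤ ‖((openHol U c i : SU N) : Matrix (Fin N) (Fin N) ℂ) - W‖ + ‖(W : Matrix (Fin N) (Fin N) ℂ) - openHol U c i'‖ := norm_sub_le_norm_sub_add_norm_sub _ _ _
    _ ≤ α + α := add_le_add (norm_openHol_sub_le_of_mem U c hW hi) (by rw [norm_sub_rev]; exact norm_openHol_sub_le_of_mem U c hW hi')
    _ = 2 * α := by ring

/-- The W-coordinate family AT AN OFF-CENTRAL OPEN HOLONOMY `b = V_{i₀}` of a nonempty window is `2α`-close to `1`. [cite: Balaban1987RG1, (0.4) p.253 and (2.9) p.266] -/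
theorem norm_coe_fibreFamily_openHol_sub_one_le (U : GaugeField P j (SU N)) (c : PBond P (j + 1)) {α : ℝ} (hα0 : 0 ≤ α) {W : SU N}
    (hW : ∀ i : Idx P, dist1 (fibreFamily U c W i) ≤ α) {i₀ : Idx P} (hi₀ : ¬ IsCentral c i₀) (i : Idx P) :
    ‖((fibreFamily U c (openHol U c i₀) i : SU N) : Matrix (Fin N) (Fin N) ℂ) - 1‖ ≤ 2 * α := by
  by_cases hi : IsCentral c i
  · rw [fibreFamily_of_isCentral U c _ i hi]; simpa using hα0
  · rw [coe_fibreFamily_of_not_isCentral U c _ i hi, norm_coe_mul_star_sub_one]; exact norm_openHol_sub_openHol_le U c hW hi hi₀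

/-- **Chart membership from a norm bound**: `‖↑k − 1‖ ≤ t`, `t < r_C`, `2t < s_C`, `t ≤ 1∕2` ⇒ `k ∈ V_{s_C}`. [cite: Helgason2000, Ch. I §1 Thm. 1.14 (13) p. 96] -/
theorem mem_window_of_norm_sub_one_le {k : SU N} {t : ℝ} (hk : ‖(k : Matrix (Fin N) (Fin N) ℂ) - 1‖ ≤ t)
    (ht1 : t < innerRadius (specialUnitaryLogChart (Fin N))) (ht2 : 2 * t < chartRadius (specialUnitaryLogChart (Fin N))) (ht3 : t ≤ 1 / 2) :
    k ∈ (isChartRep_specialUnitaryGroup (n := Fin N)).window (chartRadius (specialUnitaryLogChart (Fin N))) := by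
  rw [(isChartRep_specialUnitaryGroup (n := Fin N)).window_eq le_rfl]
  refine ⟨hk.trans_lt ht1, ?_⟩
  exact ((norm_mlog_le_two_mul (hk.trans ht3)).trans (by linarith)).trans_lt ht2

/-- **THE RADII**: under `64·α ≤ δ_N`, the constants this file needs — `0 ≤ α`-free numerics: `19α < r_C`, `38α < s_C`, `19α ≤ 1∕2`, `2α < δ_N`, `19α < 1`.
(`r_C = min(1∕3, 3∕N)`, `s_C = log(1 + r_C) ≥ r_C∕(1 + r_C)`, `δ_N = min(1∕3, π∕N)`, `π < 3.15`.) [cite: Balaban1987RG1, (2.9) p.266 (bookkeeping)] -/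
theorem radii_of_le_deltaSU {α : ℝ} (hα0 : 0 ≤ α) (hα : 64 * α ≤ deltaSU (Fin N)) :
    19 * α < innerRadius (specialUnitaryLogChart (Fin N)) ∧ 2 * (19 * α) < chartRadius (specialUnitaryLogChart (Fin N)) ∧
      19 * α ≤ 1 / 2 ∧ 2 * α < deltaSU (Fin N) ∧ 19 * α < 1 := by
  haveI : Nonempty (Fin N) := ⟨⟨0, Nat.pos_of_ne_zero (NeZero.ne N)⟩⟩
  have hN : (0 : ℝ) < (Fintype.card (Fin N) : ℝ) := Nat.cast_pos.mpr Fintype.card_pos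
  have hδ3 : deltaSU (Fin N) ≤ 1 / 3 := min_le_left _ _
  have hδπ : deltaSU (Fin N) ≤ Real.pi / Fintype.card (Fin N) := min_le_right _ _
  have hπ := Real.pi_lt_d2
  have hδpos := ExpMeanLog.deltaSU_pos (n := Fin N)
  -- `r_C = min (min (1/3) (3/N)) (1/2)`
  have hr : innerRadius (specialUnitaryLogChart (Fin N)) = min (min (1 / 3) (3 / (Fintype.card (Fin N) : ℝ))) (1 / 2) := rfl
  have h19r : 19 * α < innerRadius (specialUnitaryLogChart (Fin N)) := by
    rw [hr, lt_min_iff, lt_min_iff]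
    refine ⟨⟨by linarith, ?_⟩, by linarith⟩
    have h1 : 19 * α ≤ 19 / 64 * (Real.pi / Fintype.card (Fin N)) := by nlinarith
    have h2 : 19 / 64 * (Real.pi / Fintype.card (Fin N)) < 3 / (Fintype.card (Fin N) : ℝ) := by
      rw [mul_div_assoc', div_lt_div_iff_of_pos_right hN]; nlinarith
    exact h1.trans_lt h2
  have hrpos := innerRadius_pos (C := specialUnitaryLogChart (Fin N))
  have hr3 : innerRadius (specialUnitaryLogChart (Fin N)) ≤ 1 / 3 := by rw [hr]; exact (min_le_left _ _).trans (min_le_left _ _)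
  -- `s_C ≥ r_C / (1 + r_C) ≥ (3/4) r_C`
  have hs : 3 / 4 * innerRadius (specialUnitaryLogChart (Fin N)) ≤ chartRadius (specialUnitaryLogChart (Fin N)) := by
    have h1 := Real.one_sub_inv_le_log_of_pos (show (0 : ℝ) < 1 + innerRadius (specialUnitaryLogChart (Fin N)) by linarith)
    have h2 : 3 / 4 * innerRadius (specialUnitaryLogChart (Fin N)) ≤ 1 - (1 + innerRadius (specialUnitaryLogChart (Fin N)))⁻¹ := by
      rw [inv_eq_one_div, sub_div' (by linarith), le_div_iff₀ (by linarith)]; nlinarith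
    exact h2.trans h1
  -- `38 α < (3/4) r_C`: through `38 α ≤ (38/64) δ` and `δ ≤ 1/3`, `δ < 3.15/N`
  have h38 : 2 * (19 * α) < 3 / 4 * innerRadius (specialUnitaryLogChart (Fin N)) := by
    rw [hr, min_eq_left ((min_le_left _ _).trans (by norm_num : (1:ℝ)/3 ≤ 1/2))]
    rcases le_total (1 / 3 : ℝ) (3 / (Fintype.card (Fin N) : ℝ)) with hle | hle
    · rw [min_eq_left hle]; linarith
    · rw [min_eq_right hle]
      have h1 : 2 * (19 * α) ≤ 38 / 64 * (Real.pi / Fintype.card (Fin N)) := by nlinarith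
      have h2 : 38 / 64 * (Real.pi / Fintype.card (Fin N)) < 3 / 4 * (3 / (Fintype.card (Fin N) : ℝ)) := by
        rw [mul_div_assoc', mul_div_assoc', div_lt_div_iff_of_pos_right hN]; nlinarith
      exact h1.trans_lt h2
  exact ⟨h19r, h38.trans_le hs, by linarith, by linarith, by linarith⟩

end Geometry


/-! ## §2  The matrix model `Ê(V,A) = eml(i ↦ central ? 1 : V_i A*)·A` of the fibre map and the jointly analytic chart read
`Φ((V,B),X) = proj(log(Ê(V,B)* · Ê(V, B·e^X)))` -/

section Model

omit [NeZero N] in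
/-- The W-coordinate family in matrices is `C^∞` jointly in `(V, A)`. [cite: Balaban1987RG1, (0.4) p.253 (bookkeeping)] -/
theorem contDiff_familyM (c : PBond P (j + 1)) :
    ContDiff ℝ ⊤ (fun q : (Idx P → Matrix (Fin N) (Fin N) ℂ) × Matrix (Fin N) (Fin N) ℂ =>
      fun i : Idx P => if IsCentral c i then (1 : Matrix (Fin N) (Fin N) ℂ) else q.1 i * star q.2) := by
  refine contDiff_pi.2 fun i => ?_
  by_cases hi : IsCentral c i
  · simp only [if_pos hi]; exact contDiff_const
  · simp only [if_neg hi]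
    exact ((contDiff_apply ℝ (Matrix (Fin N) (Fin N) ℂ) i).comp contDiff_fst).mul
      ((starL' ℝ : Matrix (Fin N) (Fin N) ℂ ≃L[ℝ] Matrix (Fin N) (Fin N) ℂ).contDiff.comp contDiff_snd)

omit [NeZero N] in
/-- **The matrix model `Ê` is `C^∞` jointly in `(V, A)` at every point whose family is inside `‖· − 1‖ < 1`** (eml is analytic there).
[cite: Balaban1987RG1, (0.4) p.253; Balaban1985Averaging, (26)-(27) p.22] -/
theorem contDiffAt_modelE (c : PBond P (j + 1)) (EE : (Idx P → Matrix (Fin N) (Fin N) ℂ) → Matrix (Fin N) (Fin N) ℂ → Matrix (Fin N) (Fin N) ℂ)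
    (hEE : ∀ V A, EE V A = eml (fun i : Idx P => if IsCentral c i then (1 : Matrix (Fin N) (Fin N) ℂ) else V i * star A) * A)
    {V₀ : Idx P → Matrix (Fin N) (Fin N) ℂ} {A₀ : Matrix (Fin N) (Fin N) ℂ}
    (hsmall : ∀ i, ¬ IsCentral c i → ‖V₀ i * star A₀ - 1‖ < 1) :
    ContDiffAt ℝ ⊤ (fun q : (Idx P → Matrix (Fin N) (Fin N) ℂ) × Matrix (Fin N) (Fin N) ℂ => EE q.1 q.2) (V₀, A₀) := by
  have hfun : (fun q : (Idx P → Matrix (Fin N) (Fin N) ℂ) × Matrix (Fin N) (Fin N) ℂ => EE q.1 q.2) =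
      fun q => eml (fun i : Idx P => if IsCentral c i then (1 : Matrix (Fin N) (Fin N) ℂ) else q.1 i * star q.2) * q.2 := by
    funext q; exact hEE q.1 q.2
  rw [hfun]
  have hfam : ∀ i, ‖(fun i : Idx P => if IsCentral c i then (1 : Matrix (Fin N) (Fin N) ℂ) else V₀ i * star A₀) i - 1‖ < 1 := by
    intro i
    by_cases hi : IsCentral c i
    · simp only [if_pos hi, sub_self, norm_zero]; exact one_pos
    · simp only [if_neg hi]; exact hsmall i hi
  have heml : ContDiffAt ℝ ⊤ (eml : (Idx P → Matrix (Fin N) (Fin N) ℂ) → Matrix (Fin N) (Fin N) ℂ)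
      (fun i : Idx P => if IsCentral c i then (1 : Matrix (Fin N) (Fin N) ℂ) else V₀ i * star A₀) :=
    ((analyticAt_eml hfam).restrictScalars (𝕜 := ℝ)).contDiffAt
  exact (heml.comp (V₀, A₀) (contDiff_familyM (N := N) c).contDiffAt).mul contDiff_snd.contDiffAt

/-- **THE JOINTLY ANALYTIC CHART READ**: `Φ((V,B),X) = proj(log((Ê(V,B))* · Ê(V, B·e^X)))` is `C^∞` jointly in `((V,B),X)` at every point where the two families are inside
`‖· − 1‖ < 1` and the product is inside the log ball `‖· − 1‖ < 1`. [cite: Balaban1987RG1, (0.4) p.253 and (2.10) p.267; Helgason2000, Ch. I §1 Thm. 1.14 (13) p. 96] -/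
theorem contDiffAt_modelChart (c : PBond P (j + 1)) (EE : (Idx P → Matrix (Fin N) (Fin N) ℂ) → Matrix (Fin N) (Fin N) ℂ → Matrix (Fin N) (Fin N) ℂ)
    (hEE : ∀ V A, EE V A = eml (fun i : Idx P => if IsCentral c i then (1 : Matrix (Fin N) (Fin N) ℂ) else V i * star A) * A)
    (Φ : ((Idx P → Matrix (Fin N) (Fin N) ℂ) × Matrix (Fin N) (Fin N) ℂ) × (specialUnitaryLogChart (Fin N)).lie → (specialUnitaryLogChart (Fin N)).lie)
    (hΦ : ∀ p, Φ p = HaarExpChartLocal.proj (specialUnitaryLogChart (Fin N))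
      (mlog (star (EE p.1.1 p.1.2) * EE p.1.1 (p.1.2 * exp ((p.2 : (specialUnitaryLogChart (Fin N)).lie) : Matrix (Fin N) (Fin N) ℂ)))))
    {V₀ : Idx P → Matrix (Fin N) (Fin N) ℂ} {B₀ : Matrix (Fin N) (Fin N) ℂ} {X₀ : (specialUnitaryLogChart (Fin N)).lie}
    (h1 : ∀ i, ¬ IsCentral c i → ‖V₀ i * star B₀ - 1‖ < 1)
    (h2 : ∀ i, ¬ IsCentral c i → ‖V₀ i * star (B₀ * exp ((X₀ : (specialUnitaryLogChart (Fin N)).lie) : Matrix (Fin N) (Fin N) ℂ)) - 1‖ < 1)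
    (h3 : ‖star (EE V₀ B₀) * EE V₀ (B₀ * exp ((X₀ : (specialUnitaryLogChart (Fin N)).lie) : Matrix (Fin N) (Fin N) ℂ)) - 1‖ < 1) :
    ContDiffAt ℝ ⊤ Φ ((V₀, B₀), X₀) := by
  have hfun : Φ = fun p => HaarExpChartLocal.proj (specialUnitaryLogChart (Fin N))
      (mlog (star (EE p.1.1 p.1.2) * EE p.1.1 (p.1.2 * exp ((p.2 : (specialUnitaryLogChart (Fin N)).lie) : Matrix (Fin N) (Fin N) ℂ)))) :=
    funext hΦ
  rw [hfun]
  -- the inner map `p ↦ (Ê(V,B))* · Ê(V, B e^X)`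
  have hexpX : ContDiff ℝ ⊤ (fun p : ((Idx P → Matrix (Fin N) (Fin N) ℂ) × Matrix (Fin N) (Fin N) ℂ) × (specialUnitaryLogChart (Fin N)).lie =>
      p.1.2 * exp ((p.2 : (specialUnitaryLogChart (Fin N)).lie) : Matrix (Fin N) (Fin N) ℂ)) :=
    (contDiff_snd.comp contDiff_fst).mul
      ((Literature.Analysis.Calculus.contDiff_exp (𝔸 := Matrix (Fin N) (Fin N) ℂ)).comp
        ((specialUnitaryLogChart (Fin N)).lie.subtypeL.contDiff.comp contDiff_snd))
  have hE1 : ContDiffAt ℝ ⊤ (fun p : ((Idx P → Matrix (Fin N) (Fin N) ℂ) × Matrix (Fin N) (Fin N) ℂ) × (specialUnitaryLogChart (Fin N)).lie =>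
      EE p.1.1 p.1.2) ((V₀, B₀), X₀) :=
    (contDiffAt_modelE (N := N) c EE hEE h1).comp ((V₀, B₀), X₀) contDiff_fst.contDiffAt
  have hE2 : ContDiffAt ℝ ⊤ (fun p : ((Idx P → Matrix (Fin N) (Fin N) ℂ) × Matrix (Fin N) (Fin N) ℂ) × (specialUnitaryLogChart (Fin N)).lie =>
      EE p.1.1 (p.1.2 * exp ((p.2 : (specialUnitaryLogChart (Fin N)).lie) : Matrix (Fin N) (Fin N) ℂ))) ((V₀, B₀), X₀) := by
    have hq : ContDiffAt ℝ ⊤ (fun p : ((Idx P → Matrix (Fin N) (Fin N) ℂ) × Matrix (Fin N) (Fin N) ℂ) × (specialUnitaryLogChart (Fin N)).lie =>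
        (p.1.1, p.1.2 * exp ((p.2 : (specialUnitaryLogChart (Fin N)).lie) : Matrix (Fin N) (Fin N) ℂ))) ((V₀, B₀), X₀) :=
      ((contDiff_fst.comp contDiff_fst).prodMk hexpX).contDiffAt
    exact (contDiffAt_modelE (N := N) c EE hEE h2).comp ((V₀, B₀), X₀) hq
  have hinner : ContDiffAt ℝ ⊤ (fun p : ((Idx P → Matrix (Fin N) (Fin N) ℂ) × Matrix (Fin N) (Fin N) ℂ) × (specialUnitaryLogChart (Fin N)).lie =>
      star (EE p.1.1 p.1.2) * EE p.1.1 (p.1.2 * exp ((p.2 : (specialUnitaryLogChart (Fin N)).lie) : Matrix (Fin N) (Fin N) ℂ))) ((V₀, B₀), X₀) :=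
    ((starL' ℝ : Matrix (Fin N) (Fin N) ℂ ≃L[ℝ] Matrix (Fin N) (Fin N) ℂ).contDiff.contDiffAt.comp ((V₀, B₀), X₀) hE1).mul hE2
  have hlog : ContDiffAt ℝ ⊤ (mlog : Matrix (Fin N) (Fin N) ℂ → Matrix (Fin N) (Fin N) ℂ)
      (star (EE V₀ B₀) * EE V₀ (B₀ * exp ((X₀ : (specialUnitaryLogChart (Fin N)).lie) : Matrix (Fin N) (Fin N) ℂ))) :=
    ((analyticAt_mlog h3).restrictScalars (𝕜 := ℝ)).contDiffAt
  have hml : ContDiffAt ℝ ⊤ (fun p : ((Idx P → Matrix (Fin N) (Fin N) ℂ) × Matrix (Fin N) (Fin N) ℂ) × (specialUnitaryLogChart (Fin N)).lie =>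
      mlog (star (EE p.1.1 p.1.2) * EE p.1.1 (p.1.2 * exp ((p.2 : (specialUnitaryLogChart (Fin N)).lie) : Matrix (Fin N) (Fin N) ℂ)))) ((V₀, B₀), X₀) :=
    ContDiffAt.comp (g := (mlog : Matrix (Fin N) (Fin N) ℂ → Matrix (Fin N) (Fin N) ℂ))
      (f := fun p : ((Idx P → Matrix (Fin N) (Fin N) ℂ) × Matrix (Fin N) (Fin N) ℂ) × (specialUnitaryLogChart (Fin N)).lie =>
        star (EE p.1.1 p.1.2) * EE p.1.1 (p.1.2 * exp ((p.2 : (specialUnitaryLogChart (Fin N)).lie) : Matrix (Fin N) (Fin N) ℂ)))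
      ((V₀, B₀), X₀) hlog hinner
  exact (HaarExpChartLocal.proj (specialUnitaryLogChart (Fin N))).contDiff.contDiffAt.comp ((V₀, B₀), X₀) hml

end Model

/-! ## §3  Identification with the tree's objects: `↑(fibreMap W) = Ê(V(U), ↑W)` on the guard, and the slice of `Φ` at `(V(U), ↑b)` is the chart read
`X ↦ Λ(E(b)⁻¹·E(b·Θ X))` -/

section Identify

/-- **On the guard the fibre map is the matrix model**: `↑(fibreMap ℰ U c W) = Ê(i ↦ ↑V_i(U), ↑W)`. [cite: Balaban1987RG1, (0.4) p.253] -/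
theorem coe_fibreMap_eq_modelE (U : GaugeField P j (SU N)) (c : PBond P (j + 1))
    (EE : (Idx P → Matrix (Fin N) (Fin N) ℂ) → Matrix (Fin N) (Fin N) ℂ → Matrix (Fin N) (Fin N) ℂ)
    (hEE : ∀ V A, EE V A = eml (fun i : Idx P => if IsCentral c i then (1 : Matrix (Fin N) (Fin N) ℂ) else V i * star A) * A)
    {W : SU N} (hW : FibreSmall (expMeanLogSU (n := Fin N)) U c W) :
    ((fibreMap (expMeanLogSU (n := Fin N)) U c W : SU N) : Matrix (Fin N) (Fin N) ℂ) =
      EE (fun i => ((openHol U c i : SU N) : Matrix (Fin N) (Fin N) ℂ)) (W : Matrix (Fin N) (Fin N) ℂ) := by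
  haveI : Nonempty (Fin N) := ⟨⟨0, Nat.pos_of_ne_zero (NeZero.ne N)⟩⟩
  have hW' : ∀ i, dist1 (fibreFamily U c W i) < (expMeanLogSU (n := Fin N)).δ := hW
  rw [fibreMap_of_mem _ U c (show W ∈ fibreGuard (expMeanLogSU (n := Fin N)) U c from hW), Submonoid.coe_mul,
    coe_avg_expMeanLogSU _ hW', hEE, eml_eq_exp]
  have hsum : (∑ i : Idx P, mlog ((fibreFamily U c W i : SU N) : Matrix (Fin N) (Fin N) ℂ)) =
      ∑ i : Idx P, mlog (if IsCentral c i then (1 : Matrix (Fin N) (Fin N) ℂ) else ((openHol U c i : SU N) : Matrix (Fin N) (Fin N) ℂ) * star (W : Matrix (Fin N) (Fin N) ℂ)) := by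
    refine Finset.sum_congr rfl fun i _ => ?_
    by_cases hi : IsCentral c i
    · rw [if_pos hi, fibreFamily_of_isCentral U c W i hi]; rfl
    · rw [if_neg hi, coe_fibreFamily_of_not_isCentral U c W i hi]
  rw [hsum]

/-- Window points are guard points (`α < δ_N`). [cite: Balaban1987RG1, (0.4) p.253 and (2.9) p.266] -/
theorem fibreSmall_of_mem_window (U : GaugeField P j (SU N)) (c : PBond P (j + 1)) {α : ℝ} (hαδ : α < deltaSU (Fin N)) {W : SU N}
    (hW : ∀ i : Idx P, dist1 (fibreFamily U c W i) ≤ α) : FibreSmall (expMeanLogSU (n := Fin N)) U c W :=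
  fun i => (hW i).trans_lt hαδ

/-- The base point `b = V_{i₀}` of a nonempty window is a guard point (`2α < δ_N`). [cite: Balaban1987RG1, (0.4) p.253 and (2.9) p.266] -/
theorem fibreSmall_openHol_of_mem_window (U : GaugeField P j (SU N)) (c : PBond P (j + 1)) {α : ℝ} (hα0 : 0 ≤ α) (h2αδ : 2 * α < deltaSU (Fin N))
    {W : SU N} (hW : ∀ i : Idx P, dist1 (fibreFamily U c W i) ≤ α) {i₀ : Idx P} (hi₀ : ¬ IsCentral c i₀) :
    FibreSmall (expMeanLogSU (n := Fin N)) U c (openHol U c i₀) := by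
  intro i
  have h := norm_coe_fibreFamily_openHol_sub_one_le U c hα0 hW hi₀ i
  exact h.trans_lt h2αδ

/-- **The (0.4) correction factor of a `t`-small W-coordinate family is within `6t` of `1`** (`t ≤ 1∕2`; [Balaban1985Averaging] (26)–(27)).
[cite: Balaban1985Averaging, (26)-(27) p.22; Balaban1987RG1, (2.10) p.267] -/
theorem norm_coe_avg_fibreFamily_sub_one_le (U : GaugeField P j (SU N)) (c : PBond P (j + 1)) {W : SU N}
    (hW : FibreSmall (expMeanLogSU (n := Fin N)) U c W) {t : ℝ}
    (hfam : ∀ i : Idx P, ‖((fibreFamily U c W i : SU N) : Matrix (Fin N) (Fin N) ℂ) - 1‖ ≤ t) (ht : t ≤ 1 / 2) :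
    ‖(((expMeanLogSU (n := Fin N)).avg (fibreFamily U c W) : SU N) : Matrix (Fin N) (Fin N) ℂ) - 1‖ ≤ 6 * t := by
  haveI : Nonempty (Fin N) := ⟨⟨0, Nat.pos_of_ne_zero (NeZero.ne N)⟩⟩
  have hW' : ∀ i, dist1 (fibreFamily U c W i) < (expMeanLogSU (n := Fin N)).δ := hW
  rw [coe_avg_expMeanLogSU _ hW', ← eml_eq_exp]
  exact BlockAveragingPlaquetteBound.norm_eml_sub_one_le_six_mul (W := fun i => ((fibreFamily U c W i : SU N) : Matrix (Fin N) (Fin N) ℂ)) hfam ht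

/-- **THE TARGET-SIDE RADIUS**: for `W` in the central `α`-window and `b = V_{i₀}` off-central, `‖↑(E(b)⁻¹·E(W)) − 1‖ ≤ 19α` (`6α + 12α + α`: the two correction factors and `‖W − b‖ ≤ α`).
[cite: Balaban1987RG1, (2.10) p.267; Balaban1985Averaging, (26)-(27) p.22] -/
theorem norm_coe_fibreMap_inv_mul_sub_one_le (U : GaugeField P j (SU N)) (c : PBond P (j + 1)) {α : ℝ} (hα0 : 0 ≤ α) (h2α : 2 * α ≤ 1 / 2)
    (h2αδ : 2 * α < deltaSU (Fin N)) {W : SU N} (hW : ∀ i : Idx P, dist1 (fibreFamily U c W i) ≤ α) {i₀ : Idx P} (hi₀ : ¬ IsCentral c i₀) :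
    ‖(((fibreMap (expMeanLogSU (n := Fin N)) U c (openHol U c i₀))⁻¹ * fibreMap (expMeanLogSU (n := Fin N)) U c W : SU N) : Matrix (Fin N) (Fin N) ℂ) - 1‖ ≤ 19 * α := by
  have hαδ : α < deltaSU (Fin N) := by linarith
  have hWs : FibreSmall (expMeanLogSU (n := Fin N)) U c W := fibreSmall_of_mem_window U c hαδ hW
  have hbs : FibreSmall (expMeanLogSU (n := Fin N)) U c (openHol U c i₀) := fibreSmall_openHol_of_mem_window U c hα0 h2αδ hW hi₀
  rw [norm_coe_inv_mul_sub_one, fibreMap_of_mem _ U c (show W ∈ fibreGuard (expMeanLogSU (n := Fin N)) U c from hWs),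
    fibreMap_of_mem _ U c (show openHol U c i₀ ∈ fibreGuard (expMeanLogSU (n := Fin N)) U c from hbs), Submonoid.coe_mul, Submonoid.coe_mul]
  have ha : ‖(((expMeanLogSU (n := Fin N)).avg (fibreFamily U c W) : SU N) : Matrix (Fin N) (Fin N) ℂ) - 1‖ ≤ 6 * α :=
    norm_coe_avg_fibreFamily_sub_one_le U c hWs (norm_coe_fibreFamily_sub_one_le U c hα0 hW) (by linarith)
  have hb : ‖(((expMeanLogSU (n := Fin N)).avg (fibreFamily U c (openHol U c i₀)) : SU N) : Matrix (Fin N) (Fin N) ℂ) - 1‖ ≤ 6 * (2 * α) :=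
    norm_coe_avg_fibreFamily_sub_one_le U c hbs (norm_coe_fibreFamily_openHol_sub_one_le U c hα0 hW hi₀) h2α
  have hWb : ‖(W : Matrix (Fin N) (Fin N) ℂ) - openHol U c i₀‖ ≤ α := by rw [norm_sub_rev]; exact norm_openHol_sub_le_of_mem U c hW hi₀
  set aW : Matrix (Fin N) (Fin N) ℂ := (((expMeanLogSU (n := Fin N)).avg (fibreFamily U c W) : SU N) : Matrix (Fin N) (Fin N) ℂ) with haW
  set ab : Matrix (Fin N) (Fin N) ℂ := (((expMeanLogSU (n := Fin N)).avg (fibreFamily U c (openHol U c i₀)) : SU N) : Matrix (Fin N) (Fin N) ℂ) with hab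
  have hsplit : aW * (W : Matrix (Fin N) (Fin N) ℂ) - ab * ((openHol U c i₀ : SU N) : Matrix (Fin N) (Fin N) ℂ) =
      (aW - ab) * (W : Matrix (Fin N) (Fin N) ℂ) + ab * ((W : Matrix (Fin N) (Fin N) ℂ) - openHol U c i₀) := by noncomm_ring
  rw [hsplit]
  calc ‖(aW - ab) * (W : Matrix (Fin N) (Fin N) ℂ) + ab * ((W : Matrix (Fin N) (Fin N) ℂ) - openHol U c i₀)‖
      ≤ ‖(aW - ab) * (W : Matrix (Fin N) (Fin N) ℂ)‖ + ‖ab * ((W : Matrix (Fin N) (Fin N) ℂ) - openHol U c i₀)‖ := norm_add_le _ _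
    _ = ‖aW - ab‖ + ‖(W : Matrix (Fin N) (Fin N) ℂ) - openHol U c i₀‖ := by rw [norm_mul_coe, hab, norm_coe_mul]
    _ ≤ (‖aW - 1‖ + ‖ab - 1‖) + α := by
        refine add_le_add ?_ hWb
        calc ‖aW - ab‖ = ‖(aW - 1) - (ab - 1)‖ := by rw [sub_sub_sub_cancel_right]
          _ ≤ ‖aW - 1‖ + ‖ab - 1‖ := norm_sub_le _ _
    _ ≤ (6 * α + 6 * (2 * α)) + α := by gcongr
    _ = 19 * α := by ring

end Identify


section Slice

open Literature.MathematicalPhysics.QuantumLattice (fundamentalRep fundamentalRep_apply)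

/-- The matrix of `Θ X` is `e^X`. [cite: Helgason2000, Ch. I §1 Thm. 1.14 (13) p. 96] -/
theorem coe_expChart_SU (X : (specialUnitaryLogChart (Fin N)).lie) :
    (((isChartRep_specialUnitaryGroup (n := Fin N)).expChart X : SU N) : Matrix (Fin N) (Fin N) ℂ) =
      exp ((X : (specialUnitaryLogChart (Fin N)).lie) : Matrix (Fin N) (Fin N) ℂ) := by
  have h := (isChartRep_specialUnitaryGroup (n := Fin N)).rho_expChart X
  rwa [fundamentalRep_apply] at h

/-- **The model product is the matrix of `E(b)⁻¹·E(b·Θ X)`** on the guard. [cite: Balaban1987RG1, (0.4) p.253 and (2.10) p.267] -/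
theorem star_modelE_mul_modelE_eq_coe (U : GaugeField P j (SU N)) (c : PBond P (j + 1))
    (EE : (Idx P → Matrix (Fin N) (Fin N) ℂ) → Matrix (Fin N) (Fin N) ℂ → Matrix (Fin N) (Fin N) ℂ)
    (hEE : ∀ V A, EE V A = eml (fun i : Idx P => if IsCentral c i then (1 : Matrix (Fin N) (Fin N) ℂ) else V i * star A) * A)
    {b : SU N} (hb : FibreSmall (expMeanLogSU (n := Fin N)) U c b) {X : (specialUnitaryLogChart (Fin N)).lie}
    (hX : FibreSmall (expMeanLogSU (n := Fin N)) U c (b * (isChartRep_specialUnitaryGroup (n := Fin N)).expChart X)) :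
    star (EE (fun i => ((openHol U c i : SU N) : Matrix (Fin N) (Fin N) ℂ)) (b : Matrix (Fin N) (Fin N) ℂ)) *
      EE (fun i => ((openHol U c i : SU N) : Matrix (Fin N) (Fin N) ℂ)) ((b : Matrix (Fin N) (Fin N) ℂ) * exp ((X : (specialUnitaryLogChart (Fin N)).lie) : Matrix (Fin N) (Fin N) ℂ)) =
      (((fibreMap (expMeanLogSU (n := Fin N)) U c b)⁻¹ * fibreMap (expMeanLogSU (n := Fin N)) U c (b * (isChartRep_specialUnitaryGroup (n := Fin N)).expChart X) : SU N) :
        Matrix (Fin N) (Fin N) ℂ) := by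
  rw [Submonoid.coe_mul, coe_inv_SU, coe_fibreMap_eq_modelE U c EE hEE hb, coe_fibreMap_eq_modelE U c EE hEE hX, Submonoid.coe_mul, coe_expChart_SU]

/-- **THE SLICE OF `Φ` AT `(V(U), ↑b)` IS THE CHART READ** `X ↦ Λ(E(b)⁻¹·E(b·Θ X))` of the fibre map `E = fibreMap ℰ U c` at every `X` with `b`, `b·Θ X` in the guard and
`E(b)⁻¹·E(b·Θ X)` inside the log ball. [cite: Balaban1987RG1, (0.4) p.253 and (2.10) p.267; Helgason2000, Ch. I §1 Thm. 1.14 (13) p. 96] -/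
theorem modelChart_apply_eq_logChart (U : GaugeField P j (SU N)) (c : PBond P (j + 1))
    (EE : (Idx P → Matrix (Fin N) (Fin N) ℂ) → Matrix (Fin N) (Fin N) ℂ → Matrix (Fin N) (Fin N) ℂ)
    (hEE : ∀ V A, EE V A = eml (fun i : Idx P => if IsCentral c i then (1 : Matrix (Fin N) (Fin N) ℂ) else V i * star A) * A)
    (Φ : ((Idx P → Matrix (Fin N) (Fin N) ℂ) × Matrix (Fin N) (Fin N) ℂ) × (specialUnitaryLogChart (Fin N)).lie → (specialUnitaryLogChart (Fin N)).lie)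
    (hΦ : ∀ p, Φ p = HaarExpChartLocal.proj (specialUnitaryLogChart (Fin N))
      (mlog (star (EE p.1.1 p.1.2) * EE p.1.1 (p.1.2 * exp ((p.2 : (specialUnitaryLogChart (Fin N)).lie) : Matrix (Fin N) (Fin N) ℂ)))))
    {b : SU N} (hb : FibreSmall (expMeanLogSU (n := Fin N)) U c b) {X : (specialUnitaryLogChart (Fin N)).lie}
    (hX : FibreSmall (expMeanLogSU (n := Fin N)) U c (b * (isChartRep_specialUnitaryGroup (n := Fin N)).expChart X))
    (hk : ‖(((fibreMap (expMeanLogSU (n := Fin N)) U c b)⁻¹ *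
        fibreMap (expMeanLogSU (n := Fin N)) U c (b * (isChartRep_specialUnitaryGroup (n := Fin N)).expChart X) : SU N) : Matrix (Fin N) (Fin N) ℂ) - 1‖ <
      innerRadius (specialUnitaryLogChart (Fin N))) :
    Φ ((fun i => ((openHol U c i : SU N) : Matrix (Fin N) (Fin N) ℂ), (b : Matrix (Fin N) (Fin N) ℂ)), X) =
      (isChartRep_specialUnitaryGroup (n := Fin N)).logChart ((fibreMap (expMeanLogSU (n := Fin N)) U c b)⁻¹ *
        fibreMap (expMeanLogSU (n := Fin N)) U c (b * (isChartRep_specialUnitaryGroup (n := Fin N)).expChart X)) := by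
  have hM := star_modelE_mul_modelE_eq_coe U c EE hEE hb hX
  have hk' : ‖fundamentalRep (Fin N) ((fibreMap (expMeanLogSU (n := Fin N)) U c b)⁻¹ *
        fibreMap (expMeanLogSU (n := Fin N)) U c (b * (isChartRep_specialUnitaryGroup (n := Fin N)).expChart X)) - 1‖ <
      innerRadius (specialUnitaryLogChart (Fin N)) := by
    rw [fundamentalRep_apply]; exact hk
  have hcoe : (Φ ((fun i => ((openHol U c i : SU N) : Matrix (Fin N) (Fin N) ℂ), (b : Matrix (Fin N) (Fin N) ℂ)), X) : Matrix (Fin N) (Fin N) ℂ) =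
      (((isChartRep_specialUnitaryGroup (n := Fin N)).logChart ((fibreMap (expMeanLogSU (n := Fin N)) U c b)⁻¹ *
        fibreMap (expMeanLogSU (n := Fin N)) U c (b * (isChartRep_specialUnitaryGroup (n := Fin N)).expChart X)) : (specialUnitaryLogChart (Fin N)).lie) :
        Matrix (Fin N) (Fin N) ℂ) := by
    rw [hΦ, (isChartRep_specialUnitaryGroup (n := Fin N)).coe_logChart hk', fundamentalRep_apply]
    dsimp only
    rw [hM]
    have hmem := (isChartRep_specialUnitaryGroup (n := Fin N)).mlog_mem_lie hk'
    rw [fundamentalRep_apply] at hmem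
    exact HaarExpChartLocal.coe_proj_of_mem _ hmem
  exact Subtype.ext hcoe

end Slice

end Summit.QuantumFields.YangMills.BalabanUVNodes.N09CentralWindowChart
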